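import Literature.AlgebraicGeometry.Resolution.AlterationsProofs
import Literature.AlgebraicGeometry.Resolution.BirationalLocalIso
import Literature.AlgebraicGeometry.Motives.FunctionFieldOver
import Literature.AlgebraicGeometry.Motives.RatFnSpec
import HarnessLib

/-!
# The function field extension of an alteration is finite

Topic `Literature/AlgebraicGeometry/Resolution`. For an alteration `π : X' → X` of an integral scheme
(de Jong 1996, 2.20: `X'` integral, `π` proper dominant and finite over a non-empty open `U ⊆ X`) the
extension `K(X')/K(X)` is finite: over `U` the morphism `π⁻¹U → U` is finite dominant, so
`K(π⁻¹U)/K(U)` is finite (`Motives.FunctionFieldOver.instFiniteDimensional`, Görtz–Wedhorn II, Def. 23.76),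
and the open immersions `U ↪ X`, `π⁻¹U ↪ X'` identify the function fields compatibly with `π♯`
(`Motives.RatFn.functionFieldMap_bijective_of_isOpenImmersion`, `morphismRestrict_ι`).

## References
* A. J. de Jong, *Smoothness, semi-stability and alterations*, Publ. Math. IHÉS 83 (1996), 2.20.
* U. Görtz, T. Wedhorn, *Algebraic Geometry II* (2023), Def. 23.76.
-/

noncomputable section

open CategoryTheory AlgebraicGeometry TopologicalSpace

namespace Literature.AlgebraicGeometry.Resolution

universe u

open Literature.AlgebraicGeometry.Motives Literature.AlgebraicGeometry.Motives.RatFn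

/-- **The function field extension of an alteration is finite** (de Jong 1996, 2.20: an alteration is
generically finite, so `[K(X') : K(X)] < ∞`): for an alteration `π : X' → X` onto an integral `X`,
`K(X')` is finite-dimensional over `K(X)` (through `π♯`, i.e. as `Motives.FunctionFieldOver π`).
Proof: restrict to a non-empty open `U` over which `π` is finite, use finiteness of `K(π⁻¹U)/K(U)` for
the finite dominant `π ∣_ U` and transport along the function-field isomorphisms of the open
immersions `U ↪ X`, `π⁻¹U ↪ X'`. [cite: DeJong1996, 2.20, p. 61] -/
theorem IsAlteration.finiteDimensional_functionFieldOver {X' X : Scheme.{u}} [IsIntegral X]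
    [IsIntegral X'] {π : X' ⟶ X} [IsDominant π] (h : IsAlteration π) :
    FiniteDimensional X.functionField (FunctionFieldOver π) := by
  obtain ⟨U, hUne, hfin⟩ := h.exists_isFinite
  haveI := hfin
  obtain ⟨x, hx⟩ := hUne
  haveI : Nonempty U := ⟨⟨x, hx⟩⟩
  haveI : IsDominant (π ∣_ U) := IsZariskiLocalAtTarget.restrict ‹IsDominant π› U
  haveI : Nonempty (π ⁻¹ᵁ U) := nonempty_preimage_of_isDominant π U
  haveI : IsIntegral (π ⁻¹ᵁ U : Scheme.{u}) := isIntegral_of_isOpenImmersion (π ⁻¹ᵁ U).ι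
  haveI : IsIntegral (U : Scheme.{u}) := isIntegral_of_isOpenImmersion U.ι
  haveI : IsDominant U.ι :=
    ⟨by rw [DenseRange, Scheme.Opens.range_ι]; exact U.2.dense ⟨x, hx⟩⟩
  haveI : IsDominant (π ⁻¹ᵁ U).ι :=
    ⟨by rw [DenseRange, Scheme.Opens.range_ι]
        exact (π ⁻¹ᵁ U).2.dense (Set.nonempty_coe_sort.mp ‹Nonempty (π ⁻¹ᵁ U)›)⟩
  -- `K(π⁻¹U)/K(U)` is finite
  haveI : FiniteDimensional (U : Scheme.{u}).functionField (FunctionFieldOver (π ∣_ U)) :=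
    inferInstance
  -- the function-field isomorphisms of the open immersions
  let e₁ : X.functionField ≃+* (U : Scheme.{u}).functionField :=
    RingEquiv.ofBijective (functionFieldMap U.ι) (functionFieldMap_bijective_of_isOpenImmersion U.ι)
  let e₂ : X'.functionField ≃+* (π ⁻¹ᵁ U : Scheme.{u}).functionField :=
    RingEquiv.ofBijective (functionFieldMap (π ⁻¹ᵁ U).ι)
      (functionFieldMap_bijective_of_isOpenImmersion (π ⁻¹ᵁ U).ι)
  -- compatibility with `π♯`: `(π⁻¹U ↪ X')♯ ∘ π♯ = (π ∣_ U)♯ ∘ (U ↪ X)♯`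
  have key : ∀ s : X.functionField,
      functionFieldMap (π ⁻¹ᵁ U).ι (functionFieldMap π s) =
        functionFieldMap (π ∣_ U) (functionFieldMap U.ι s) := by
    intro s
    rw [← RingHom.comp_apply, ← functionFieldMap_comp π (π ⁻¹ᵁ U).ι, ← RingHom.comp_apply,
      ← functionFieldMap_comp U.ι (π ∣_ U), functionFieldMap_congr (morphismRestrict_ι π U)]
  let E₁ : (U : Scheme.{u}).functionField ≃+* X.functionField := e₁.symm
  let E₂ : FunctionFieldOver (π ∣_ U) ≃+* FunctionFieldOver π :=
    (FunctionFieldOver.of (π ∣_ U)).symm.trans (e₂.symm.trans (FunctionFieldOver.of π))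
  refine Module.Finite.of_equiv_equiv (A₁ := (U : Scheme.{u}).functionField)
    (B₁ := FunctionFieldOver (π ∣_ U)) E₁ E₂ ?_
  refine RingHom.ext fun t => ?_
  obtain ⟨s, rfl⟩ := e₁.surjective t
  change algebraMap X.functionField (FunctionFieldOver π) (e₁.symm (e₁ s)) =
    E₂ (algebraMap _ (FunctionFieldOver (π ∣_ U)) (e₁ s))
  rw [e₁.symm_apply_apply, FunctionFieldOver.algebraMap_apply, FunctionFieldOver.algebraMap_apply]
  change FunctionFieldOver.of π (functionFieldMap π s) =
    FunctionFieldOver.of π (e₂.symm (functionFieldMap (π ∣_ U) (e₁ s)))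
  congr 1
  apply e₂.injective
  rw [e₂.apply_symm_apply]
  exact key s

end Literature.AlgebraicGeometry.Resolution

end
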